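import Mathlib
import HarnessLib
import Literature.Probability.Percolation.MinOpenCut
import Summits.CriticalPhenomena.PercolationContinuityZ3.Theorems.PercBudgetLadderBudgetTightnessStubTauLimit

/-!
# `stub_feketeLimit` of line `Sketch` (crux `BudgetTightness`, stmt-CriticalPhenomena-5248):
# Kesten's slab flow constant as a limit in `[0, 1]`

`stub_feketeLimit` is the form of the slab-flow-constant stub used by the skeleton of lead
`prover-line-stmt-CriticalPhenomena-5248-1` (registered on the item by `workitem stub-add`): for
`h ≥ 1`, `E_p[S(L,h)]/(L+1)² → τ` for some `τ ∈ [0, 1]` with `E_p[S(L,h)] ≤ τ (L+1)²` for every `L`,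
where `S(L,h) = minOpenCutIn Q(L,h) bottom top` is the bottom-to-top min-cut budget of the slab piece
`Q(L,h) = [0,L]² × [0,h] ⊆ ℤ³` (`MinOpenCut.lean`). It is a COROLLARY of the landed `stub_tauLimit`
(`Theorems/PercBudgetLadderBudgetTightnessStubTauLimit.lean`: existence of `τ` with the two clauses,
every `h`): the extra normalisation `0 ≤ τ ≤ 1` passes to the limit from
`0 ≤ E_p[S(L,h)] ≤ (L+1)²` (`integral_nonneg`, `StubTauLimit.integral_sl_le_sq`, `h ≥ 1`) by
`ge_of_tendsto'` / `le_of_tendsto'`. No lemma of the sibling file is re-proved here.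
-/

noncomputable section

namespace Summit.CriticalPhenomena.PercolationContinuityZ3.Theorems.BudgetTightness

open MeasureTheory Filter Topology
open Literature.Probability.Percolation Literature.Probability.LatticeModels

/-- **`stub_feketeLimit`** (Kesten's slab flow constant `τ_h(p) = lim_L E_p[S(L,h)]/(L+1)²` exists,
lies in `[0, 1]`, and `E_p[S(L,h)] ≤ τ_h(p) (L+1)²` for every `L`; `h ≥ 1`). Corollary of
`stub_tauLimit` (limit and supremum clause) and of `0 ≤ E_p[S(L,h)] ≤ (L+1)²`
(`integral_nonneg`, `StubTauLimit.integral_sl_le_sq`), the bounds passing to the limit. -/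
theorem stub_feketeLimit :
    ∀ (p : unitInterval) (h : ℕ), 1 ≤ h →
      ∃ τ : ℝ, 0 ≤ τ ∧ τ ≤ 1 ∧
        Filter.Tendsto (fun L : ℕ => (∫ ω, ((minOpenCutIn
            (Set.Icc (![0, 0, 0] : Site 3) ![(L : ℤ), (L : ℤ), (h : ℤ)])
            (Set.Icc (![0, 0, 0] : Site 3) ![(L : ℤ), (L : ℤ), 0])
            (Set.Icc (![0, 0, (h : ℤ)] : Site 3) ![(L : ℤ), (L : ℤ), (h : ℤ)])
            ω).toNat : ℝ) ∂(bondPercolation (zdGraph 3) p)) / ((L : ℝ) + 1) ^ 2)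
          Filter.atTop (nhds τ) ∧
        ∀ L : ℕ, ∫ ω, ((minOpenCutIn
            (Set.Icc (![0, 0, 0] : Site 3) ![(L : ℤ), (L : ℤ), (h : ℤ)])
            (Set.Icc (![0, 0, 0] : Site 3) ![(L : ℤ), (L : ℤ), 0])
            (Set.Icc (![0, 0, (h : ℤ)] : Site 3) ![(L : ℤ), (L : ℤ), (h : ℤ)])
            ω).toNat : ℝ) ∂(bondPercolation (zdGraph 3) p) ≤ τ * ((L : ℝ) + 1) ^ 2 := by
  intro p h hh
  obtain ⟨τ, hle, hlim⟩ := stub_tauLimit p h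
  have hpos : ∀ L : ℕ, (0 : ℝ) < ((L : ℝ) + 1) ^ 2 := fun L => by positivity
  refine ⟨τ, ge_of_tendsto' hlim fun L => ?_, le_of_tendsto' hlim fun L => ?_, hlim, hle⟩
  · exact div_nonneg (integral_nonneg fun _ => Nat.cast_nonneg _) (hpos L).le
  · exact (div_le_one (hpos L)).2 (StubTauLimit.integral_sl_le_sq p hh L)

end Summit.CriticalPhenomena.PercolationContinuityZ3.Theorems.BudgetTightness

end
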